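import Summits.CriticalPhenomena.PercolationContinuityZ3.Theorems.Transplant.FKThreeApexT3EnvelopeCertHalf
import Summits.CriticalPhenomena.PercolationContinuityZ3.Theorems.Transplant.FKThreeApexNegCorrT5
import Summits.CriticalPhenomena.PercolationContinuityZ3.Theorems.Transplant.FKThreeApexToric
import HarnessLib

/-!
# `K_{1,1,1,n}`: two leaf edges at different apices and different leaves are negatively correlated (type T3), `1/2 ≤ q ≤ 1`

Support file (`--supports stmt-CriticalPhenomena-4575`), FK sub-lane `prim-bschramm-fk-3` (gen 16); builds on p205010 (kernel theorem, internal audit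
signed; external expert review pending).  No named facts, no sorries; standard axioms.  Memo `bschramm/prim-bschramm-fk-3/T3-ENVELOPE.md`.

Setting of `…ThreeApexNegCorrTri` / `…NegCorrT5` (weighted `K_{1,1,1,n}`: apices `a,b,c`, leaves `v j`, arbitrary parameters `w` on the full
pattern).  The LAST pair type, T3: **`negCorrTri_T3_of_half_le`** — for distinct apices `x ≠ y` and distinct leaves `j₁ ≠ j₂` the leaf edges
`s(x, v j₁)`, `s(y, v j₂)` satisfy `φ(J_e ∩ J_f) ≤ φ(J_e) φ(J_f)` for every `q ∈ [1/2, 1]`; core case `negCorrTri_leaf_ab_leaf_of_half_le`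
(`x = a`, `y = b`) from the monoid inequality `InK.t3Form_nonneg_of_half_le` (the double-envelope reduction `…T3Envelope/…Reduction` and the
exact LP certificate `…CertHalf`) by the transfer formula and the pinning tools (`zvec_pin_ab` of `…Toric`, `negCorr_of_pinned_rayleigh`), the other apex
pairs by relabelling.  With `negCorr_adjacent_tri` (T1, T2, T4, T6) and `negCorrTri_leaf_triangle` (T4, T5), ALL pairs of edges of the weighted
`K_{1,1,1,n}` are negatively correlated for `q ∈ [1/2, 1]` (`negCorrTri_allPairs_of_half_le`); the range `[3/10, 1]` follows in `…NegCorrT3Third` from the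
`[3/10,1/2]` certificate; for smaller `q` the T3 pairs are reduced to the two-parameter statement `EnvelopeA q`.
[cite: Grimmett2006, §3.9 eq. (3.94), Conj. (3.96) (pp. 63–66)] [cite: Wagner2006, Conj. 5.3 (p. 13)]
-/

noncomputable section

namespace Summit.CriticalPhenomena.PercolationContinuityZ3.Theorems

namespace FK

namespace ThreeApex

/-! ### Type T3 at the measure level -/

section Setting

open Literature.Probability.LatticeModels Literature.Probability.Percolation
open scoped Classical

variable {V : Type*} [Fintype V]
variable {a b c : V} {v : ℕ → V} {n : ℕ}
variable (hab : a ≠ b) (hac : a ≠ c) (hbc : b ≠ c) (hinj : ∀ j k, j < n → k < n → v j = v k → j = k)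
  (hva : ∀ j, j < n → v j ≠ a) (hvb : ∀ j, j < n → v j ≠ b) (hvc : ∀ j, j < n → v j ≠ c)
include hab hac hbc hinj hva hvb hvc

/-- **T3 in `K_{1,1,1,n}` for `q ∈ [1/2, 1]`** (core case): the leaf edges `s(a, v j₁)` and `s(b, v j₂)` at DIFFERENT apices and DIFFERENT leaves are
negatively correlated under `φ_{w,q}` for arbitrary weights on the full pattern `K_{1,1,1,n}`.
(transcription of bschramm/prim-bschramm-fk-3/T3-ENVELOPE.md §2, §6) -/
theorem negCorrTri_leaf_ab_leaf_of_half_le {q : ℝ} (hq : 1 / 2 ≤ q) (hq1 : q ≤ 1) (hcard : Fintype.card V = n + 3)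
    (w : Sym2 V → unitInterval) (hsupp : ∀ e, e ∉ fullPairs a b c v n → w e = 0) {j₁ j₂ : ℕ} (hj₁ : j₁ < n) (hj₂ : j₂ < n)
    (hne : j₁ ≠ j₂) :
    (rcMeasureW w q ∅).real ({ω : BondConfig V | s(a, v j₁) ∈ ω} ∩ {ω | s(b, v j₂) ∈ ω}) ≤
      (rcMeasureW w q ∅).real {ω : BondConfig V | s(a, v j₁) ∈ ω} * (rcMeasureW w q ∅).real {ω : BondConfig V | s(b, v j₂) ∈ ω} := by
  have hq0 : 0 < q := by linarith
  have hfe : s(b, v j₂) ≠ s(a, v j₁) := (pair_ne_of_ne hinj hva hvb hvc (x := a) (y := b) (Or.inl rfl) hj₁ hj₂ hne).symm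
  have he : s(a, v j₁) ∈ fullPairs a b c v n := mem_fullPairs_of (Or.inl ((mem_apexPairs_iff _).2 ⟨j₁, hj₁, Or.inl rfl⟩))
  have hf : s(b, v j₂) ∈ fullPairs a b c v n := mem_fullPairs_of (Or.inl ((mem_apexPairs_iff _).2 ⟨j₂, hj₂, Or.inr (Or.inl rfl)⟩))
  set R := triLetter w a b c * ∏ j ∈ ((Finset.range n).erase j₁).erase j₂, leafOf q w a b c (v j) with hR
  have hRK : InK q R := (inK_triLetter q w a b c).mul (inK_prod _ _ fun j _ => isLetter_leafOf q w a b c (v j))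
  have hZ : ∀ σ τ : unitInterval, rcPartitionFunctionW (Function.update (Function.update w s(a, v j₁) σ) s(b, v j₂) τ) q ∅ =
      val q (leaf q (σ : ℝ) ((w s(b, v j₁) : unitInterval) : ℝ) ((w s(c, v j₁) : unitInterval) : ℝ) *
        (leaf q ((w s(a, v j₂) : unitInterval) : ℝ) (τ : ℝ) ((w s(c, v j₂) : unitInterval) : ℝ) * R)) := by
    intro σ τ
    rw [rcPartitionFunctionW_eq_transfer3T hab hac hbc hinj hva hvb hvc hcard q _
      (supp_update_fullPair _ (supp_update_fullPair w hsupp he σ) hf τ), transfer3T,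
      triLetter_pin_leaves hva hvb hvc w a b hj₁ hj₂ σ τ, zvec_pin_ab hab hac hbc hinj hva hvb hvc q w hj₁ hj₂ hne σ τ, hR]
    congr 1
    ac_rfl
  refine negCorr_of_pinned_rayleigh w hq0 hfe ?_
  rw [hZ, hZ, hZ, hZ, Set.Icc.coe_one, Set.Icc.coe_zero]
  have h := InK.t3Form_nonneg_of_half_le hq hq1 (w s(b, v j₁)).2.1 (w s(b, v j₁)).2.2 (w s(c, v j₁)).2.1 (w s(c, v j₁)).2.2
    (w s(a, v j₂)).2.1 (w s(a, v j₂)).2.2 (w s(c, v j₂)).2.1 (w s(c, v j₂)).2.2 hRK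
  rw [← rayleigh_T3_eq] at h
  simp only [← mul_def] at h
  linarith

/-- **T3 in `K_{1,1,1,n}` for `q ∈ [1/2, 1]`**: for distinct apices `x ≠ y` and distinct leaves `j₁ ≠ j₂` the leaf edges `s(x, v j₁)`, `s(y, v j₂)` are
negatively correlated (relabelling of the core case). (transcription of bschramm/prim-bschramm-fk-3/T3-ENVELOPE.md §2, §6) -/
theorem negCorrTri_T3_of_half_le {q : ℝ} (hq : 1 / 2 ≤ q) (hq1 : q ≤ 1) (hcard : Fintype.card V = n + 3) (w : Sym2 V → unitInterval)
    (hsupp : ∀ e, e ∉ fullPairs a b c v n → w e = 0) {j₁ j₂ : ℕ} (hj₁ : j₁ < n) (hj₂ : j₂ < n) (hne : j₁ ≠ j₂) {x y : V}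
    (hx : x = a ∨ x = b ∨ x = c) (hy : y = a ∨ y = b ∨ y = c) (hxy : x ≠ y) :
    (rcMeasureW w q ∅).real ({ω : BondConfig V | s(x, v j₁) ∈ ω} ∩ {ω | s(y, v j₂) ∈ ω}) ≤
      (rcMeasureW w q ∅).real {ω : BondConfig V | s(x, v j₁) ∈ ω} * (rcMeasureW w q ∅).real {ω : BondConfig V | s(y, v j₂) ∈ ω} := by
  -- the six ordered pairs of distinct apices, each a relabelling of the core case (a, b)
  have hAB := negCorrTri_leaf_ab_leaf_of_half_le hab hac hbc hinj hva hvb hvc hq hq1 hcard w hsupp hj₁ hj₂ hne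
  have hBA := negCorrTri_leaf_ab_leaf_of_half_le hab.symm hbc hac hinj hvb hva hvc hq hq1 hcard w
    (by rw [fullPairs_swap₁₂]; exact hsupp) hj₁ hj₂ hne
  have hAC := negCorrTri_leaf_ab_leaf_of_half_le hac hab hbc.symm hinj hva hvc hvb hq hq1 hcard w
    (by rw [fullPairs_swap₂₃]; exact hsupp) hj₁ hj₂ hne
  have hCA := negCorrTri_leaf_ab_leaf_of_half_le hac.symm hbc.symm hab hinj hvc hva hvb hq hq1 hcard w
    (by rw [fullPairs_rotate, fullPairs_rotate]; exact hsupp) hj₁ hj₂ hne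
  have hBC := negCorrTri_leaf_ab_leaf_of_half_le hbc hab.symm hac.symm hinj hvb hvc hva hq hq1 hcard w
    (by rw [fullPairs_rotate]; exact hsupp) hj₁ hj₂ hne
  have hCB := negCorrTri_leaf_ab_leaf_of_half_le hbc.symm hac.symm hab.symm hinj hvc hvb hva hq hq1 hcard w
    (by rw [← fullPairs_swap₂₃, fullPairs_rotate, fullPairs_rotate]; exact hsupp) hj₁ hj₂ hne
  rcases hx with rfl | rfl | rfl <;> rcases hy with rfl | rfl | rfl
  · exact absurd rfl hxy
  · exact hAB
  · exact hAC
  · exact hBA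
  · exact absurd rfl hxy
  · exact hBC
  · exact hCA
  · exact hCB
  · exact absurd rfl hxy

/-- **Every pair of edges of the weighted `K_{1,1,1,n}` is negatively correlated for `q ∈ [1/2, 1]`** (Potts–Rayleigh on this range): triangle pairs and
adjacent pairs for all `0 < q ≤ 1` (`negCorrTri_triangle_any`, `negCorrTri_leaf`, `negCorrTri_apex`), the T3 pairs by `negCorrTri_T3_of_half_le`.
(transcription of bschramm/prim-bschramm-fk-3/T3-ENVELOPE.md §6–§7) -/
theorem negCorrTri_allPairs_of_half_le {q : ℝ} (hq : 1 / 2 ≤ q) (hq1 : q ≤ 1) (hcard : Fintype.card V = n + 3)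
    (w : Sym2 V → unitInterval) (hsupp : ∀ e, e ∉ fullPairs a b c v n → w e = 0) {e f : Sym2 V} (he : e ∈ fullPairs a b c v n)
    (hf : f ∈ fullPairs a b c v n) (hfe : f ≠ e) :
    (rcMeasureW w q ∅).real ({ω : BondConfig V | e ∈ ω} ∩ {ω | f ∈ ω}) ≤
      (rcMeasureW w q ∅).real {ω : BondConfig V | e ∈ ω} * (rcMeasureW w q ∅).real {ω : BondConfig V | f ∈ ω} := by
  have hq0 : 0 < q := by linarith
  rcases (mem_fullPairs_iff a b c v n f).1 hf with hf' | hf'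
  · rcases (mem_fullPairs_iff a b c v n e).1 he with he' | he'
    · obtain ⟨j₁, hj₁, hx⟩ := (mem_apexPairs_iff (a := a) (b := b) (c := c) (v := v) (n := n) e).1 he'
      obtain ⟨j₂, hj₂, hy⟩ := (mem_apexPairs_iff (a := a) (b := b) (c := c) (v := v) (n := n) f).1 hf'
      -- e = s(x, v j₁), f = s(y, v j₂)
      have key : ∀ (x y : V), (x = a ∨ x = b ∨ x = c) → (y = a ∨ y = b ∨ y = c) → e = s(x, v j₁) → f = s(y, v j₂) →
          (rcMeasureW w q ∅).real ({ω : BondConfig V | e ∈ ω} ∩ {ω | f ∈ ω}) ≤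
            (rcMeasureW w q ∅).real {ω : BondConfig V | e ∈ ω} * (rcMeasureW w q ∅).real {ω : BondConfig V | f ∈ ω} := by
        intro x y hxa hya hex hfy
        subst hex; subst hfy
        by_cases hj : j₁ = j₂
        · subst hj
          have hxy : x ≠ y := fun h => hfe (by rw [h])
          exact negCorrTri_leaf hab hac hbc hinj hva hvb hvc hq0 hq1 hcard w hsupp hj₁ hxa hya hxy
        · by_cases hxy : x = y
          · subst hxy
            exact negCorrTri_apex hab hac hbc hinj hva hvb hvc hq0 hq1 hcard w hsupp hj₁ hj₂ hj hxa
          · exact negCorrTri_T3_of_half_le hab hac hbc hinj hva hvb hvc hq hq1 hcard w hsupp hj₁ hj₂ hj hxa hya hxy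
      rcases hx with hx | hx | hx <;> rcases hy with hy | hy | hy
      · exact key a a (Or.inl rfl) (Or.inl rfl) hx hy
      · exact key a b (Or.inl rfl) (Or.inr (Or.inl rfl)) hx hy
      · exact key a c (Or.inl rfl) (Or.inr (Or.inr rfl)) hx hy
      · exact key b a (Or.inr (Or.inl rfl)) (Or.inl rfl) hx hy
      · exact key b b (Or.inr (Or.inl rfl)) (Or.inr (Or.inl rfl)) hx hy
      · exact key b c (Or.inr (Or.inl rfl)) (Or.inr (Or.inr rfl)) hx hy
      · exact key c a (Or.inr (Or.inr rfl)) (Or.inl rfl) hx hy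
      · exact key c b (Or.inr (Or.inr rfl)) (Or.inr (Or.inl rfl)) hx hy
      · exact key c c (Or.inr (Or.inr rfl)) (Or.inr (Or.inr rfl)) hx hy
    · -- e triangle, f apex: symmetric of `negCorrTri_triangle_any`
      exact negCorr_symm (negCorrTri_triangle_any hab hac hbc hinj hva hvb hvc hq0 hq1 hcard w hsupp hf he' hfe.symm)
  · exact negCorrTri_triangle_any hab hac hbc hinj hva hvb hvc hq0 hq1 hcard w hsupp he hf' hfe

end Setting

end ThreeApex

end FK

end Summit.CriticalPhenomena.PercolationContinuityZ3.Theorems
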